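import Mathlib
import HarnessLib

/-!
# Crux `SignCone.ConeMagnification` (stmt-RiemannHypothesis-16303), line `Sketch`: vocabulary of the
# finite design spine (stub `stub_deficitOfDesign`)

Route `RiemannHypothesis/SignCone`, crux `ConeMagnification` (item stmt-RiemannHypothesis-16303), line `Sketch`
(skeleton r6, lead `prover-line-stmt-RiemannHypothesis-16303-c1`).  Definitions (NO stub proofs) shared by the
`--supports` files `SignConeConeMagnificationDesignSpineA/B.lean` and
`SignConeConeMagnificationStubDeficitOfDesign.lean`, which together prove the registered stub
`stub_deficitOfDesign`: the FINITE SPINE of the 2001 W-MAG programme (its §5, "design bookkeeping"), turning the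
three pieces of *design data* of a weight `c : ℕ → ℝ` with defect `d = c − Λ` at slack `M`,

* (AX-A) `Σ_n |d(n)|/n < ∞`,
* (AX-B) the composite-mass series `Σ_{n composite, not a prime power} (c(n)/n)·e₂(n)` converges,
  `e₂(n) = Σ_{q < q' primes ∣ n} τ_q τ_{q'}`, `τ_p = (√p − 1)/2`,
* (AX-C) the Riesz–Euler design inequality `Σ'_n (d(n)/n)·Φ_{S,a,φ}(n) ≤ M/2` for every finite set `S` of
  primes, weights `a_p ∈ [0,1]` and phase `φ`,

into summability of the one-sided prime deficit `Σ_p (log p − c(p))₊ p^{-σ}` for every `σ > 1/2`.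

Everything here is adapted from the prior programme's kernel-checked stockroom file
`reserve/prior-2001/Prior/RiemannHypothesis/RiemannHypothesis/Rh_WMagnificationY1_MagDeficit.lean` (2001 programme,
namespace `RHWMagnification`), with two changes: the interface structure `DesignData M c` is NOT reproduced (the
spine lemmas take the pieces of design data they use as explicit hypotheses, and the junk-value field
`hc0 : c 0 = 0` disappears: every series below has the term `x / 0 = 0` at index `0`, so no statement ever sees
`c 0`), and the pollution predicate is folded into the real-valued summand `pollutedTerm`.  All names live in the
sub-namespace `….SignConeConeMagnification.Design`.

In this file (definitions, plus the `rfl` anchor `stub_deficitOfDesign_vocab` through which it lands `--supports`;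
every docstring says what the object is and which junk values it carries):

* `dwt c n = c n − Λ n` (the defect), `tauP p = (√p − 1)/2`, `eTwo n = Σ_{q<q'} τ_q τ_{q'}` over prime divisors,
  `compMassTerm c n` (the AX-B summand), `deficitTerm c p = 𝟙_{p prime} (log p − c p)₊/√p`;
* `designWeight a φ A = √(n_A)·(Π_{p∈A} a_p)·2^{-|A|}·cos(|A|φ)` (`n_A = Π_{p∈A} p`),
  `profile S a φ n` (the Riesz–Euler profile `Φ_{S,a,φ}(n)`), `rho c S m = Σ_{k ≥ 1, (k, Π_S p) = 1} d(mk)/(mk)`;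
* `slice`, `uCoeff` (regrouping of the design series by `S`-smooth parts),
  `piZ c z p` (the composite remainder of `√p·ρ_{S_z}(p)`, `S_z = Nat.primesLE z`), `cTau = 2√2/(√2−1)`,
  `pollutedTerm c z p n` (the pollution series summand).

NOT here: any analytic input (the design data themselves are produced by the open core `stub_designOfOffline`
of the skeleton), the Landau transfer (`stub_transfer`), and all proofs (spine files A/B and the stub file).
-/

noncomputable section

-- `Summit.RiemannHypothesis.RiemannHypothesis.…` repeats a namespace component by design (D-0017 layout).
set_option linter.dupNamespace false

open Finset

namespace Summit.RiemannHypothesis.RiemannHypothesis.Theorems.SignConeConeMagnification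

namespace Design

/-! ### The weight, its defect, and the two series of the design data -/

-- adapted from reserve/prior-2001/Prior/RiemannHypothesis/RiemannHypothesis/Rh_WMagnificationY1_MagDeficit.lean (2001 programme)
/-- The defect `d = c − Λ` of a weight `c : ℕ → ℝ` (2001 W-MAG §1.4). [folklore] -/
def dwt (c : ℕ → ℝ) (n : ℕ) : ℝ := c n - ArithmeticFunction.vonMangoldt n

/-- `τ_p = (√p − 1)/2`, the local-vector parameter of the Riesz–Euler design (2001 W-MAG §4). [folklore] -/
def tauP (p : ℕ) : ℝ := (Real.sqrt p - 1) / 2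

/-- `e₂(n) = Σ_{q<q'} τ_q τ_{q'}` over pairs of distinct prime divisors `q < q'` of `n`
(2001 W-MAG §4, display before Prop. 4.3); `e₂(0) = e₂(1) = 0` (empty sums). [folklore] -/
def eTwo (n : ℕ) : ℝ :=
  ∑ q ∈ n.primeFactors, ∑ q' ∈ n.primeFactors.filter (fun q' => q < q'), tauP q * tauP q'

/-- The composite-mass summand `𝟙_{n ≥ 2, n not a prime power} · (c(n)/n)·e₂(n)` of AX-B
(2001 W-MAG Prop. 4.3(i)). [folklore] -/
def compMassTerm (c : ℕ → ℝ) (n : ℕ) : ℝ :=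
  if 2 ≤ n ∧ ¬ IsPrimePow n then c n / n * eTwo n else 0

/-- The deficit summand at the scale `1/2`: `𝟙_{p prime} · (log p − c(p))₊ / √p`
(2001 W-MAG Thm 1.2(i) / Thm 5.4). [folklore] -/
def deficitTerm (c : ℕ → ℝ) (p : ℕ) : ℝ :=
  if p.Prime then max (Real.log p - c p) 0 / Real.sqrt p else 0

/-! ### The Riesz–Euler design profile (2001 W-MAG §5)

For a finite set `S` of primes, coefficients `a : S → [0,1]` and a rotation angle `φ`, the profile of the
Riesz–Euler product resonator is `Φ(n) = √(n_A)·(Π_{p∈A} a_p)·2^{−|A|}·cos(|A|φ)` when `p² ∤ n` for all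
`p ∈ S`, where `A = {p ∈ S : p ∣ n}`, and `Φ(n) = 0` when `p² ∣ n` for some `p ∈ S`. -/

/-- The `φ`-dependent design weight `√(n_A)·(Π_{p∈A} a_p)·(1/2)^{|A|}·cos(|A| φ)` attached to a finite set
`A` of primes (2001 W-MAG Prop. 5.3). [folklore] -/
def designWeight (a : ℕ → ℝ) (φ : ℝ) (A : Finset ℕ) : ℝ :=
  Real.sqrt (∏ p ∈ A, (p : ℝ)) * (∏ p ∈ A, a p) * (1/2) ^ A.card
    * Real.cos (A.card * φ)

/-- The Riesz–Euler profile `n ↦ Φ_{S,a,φ}(n)`: the design weight of `A = {p ∈ S : p ∣ n}` if `n` is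
squarefree at `S`, else `0` (2001 W-MAG, proof of Prop. 5.3).  At `n = 0` every `p² ∣ 0`, so the
profile is `designWeight a φ S` if `S = ∅` and `0` otherwise; it is only ever used multiplied by
`d(n)/n`, which vanishes at `n = 0`. [folklore] -/
def profile (S : Finset ℕ) (a : ℕ → ℝ) (φ : ℝ) (n : ℕ) : ℝ :=
  if ∀ p ∈ S, ¬ (p ^ 2 ∣ n) then designWeight a φ (S.filter (· ∣ n)) else 0

/-- `ρ_S(m) = Σ_{k ≥ 1, (k, Π_S p) = 1} d(mk)/(mk)` (2001 W-MAG eq. (rho)); a `tsum`, so `0` if the series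
diverges (it converges absolutely under AX-A, `Design.summable_ite_dwt`). [folklore] -/
def rho (c : ℕ → ℝ) (S : Finset ℕ) (m : ℕ) : ℝ :=
  ∑' k : ℕ, if 1 ≤ k ∧ Nat.Coprime k (∏ p ∈ S, p)
    then dwt c (m * k) / ((m * k : ℕ) : ℝ) else 0

/-! ### Regrouping vocabulary (2001 W-MAG eq. (marginal) / (EtA)) -/

/-- The `A`-slice of the design series: the terms `d(n)/n · w_A` over the `n ≥ 1` squarefree at `S` whose set
of `S`-prime divisors is exactly `A`. [folklore] -/
def slice (c : ℕ → ℝ) (S : Finset ℕ) (a : ℕ → ℝ) (φ : ℝ) (A : Finset ℕ) (n : ℕ) : ℝ :=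
  if S.filter (· ∣ n) = A ∧ (∀ p ∈ S, ¬ (p ^ 2 ∣ n)) ∧ 1 ≤ n
  then dwt c n / (n : ℝ) * designWeight a φ A else 0

/-- The `φ`-free coefficient `u_A = √(n_A)·(Π_{p∈A} a_p)·2^{−|A|}·ρ_S(n_A)` (2001 W-MAG Prop. 5.3). [folklore] -/
def uCoeff (c : ℕ → ℝ) (S : Finset ℕ) (a : ℕ → ℝ) (A : Finset ℕ) : ℝ :=
  Real.sqrt (∏ p ∈ A, (p : ℝ)) * (∏ p ∈ A, a p) * (1/2) ^ A.card * rho c S (∏ p ∈ A, p)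

/-! ### Vocabulary of the deficit extraction (2001 W-MAG Thm 5.4) -/

/-- `π_z(p) = √p · Σ_{k ≥ 2, (k, Π_{S_z} q) = 1} c(pk)/(pk)` (`S_z = Nat.primesLE z`, the primes `≤ z`), the composite
remainder of `√p·ρ_{S_z}(p)` (2001 W-MAG, proof of Thm 5.4); a `tsum` (it converges under AX-A). [folklore] -/
def piZ (c : ℕ → ℝ) (z p : ℕ) : ℝ :=
  Real.sqrt p * ∑' k : ℕ, if 2 ≤ k ∧ Nat.Coprime k (∏ q ∈ Nat.primesLE z, q)
    then c (p * k) / ((p * k : ℕ) : ℝ) else 0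

/-- `C_τ = 2√2/(√2−1) = max_{p ≥ 2} √p/τ_p` (2001 W-MAG eq. (pollution)). [folklore] -/
def cTau : ℝ := 2 * Real.sqrt 2 / (Real.sqrt 2 - 1)

/-- The pollution series summand of `p` at level `z`: `compMassTerm c n` if `n` is a *pollution index* for `p`
(`p ∣ n`, `n ≥ 2` is not a prime power, and every prime factor of `n` other than `p` exceeds `z`; 2001 W-MAG
eq. (pollution): `n = p·n'` with `p ≤ z < P⁻(n')`), else `0`. [folklore] -/
def pollutedTerm (c : ℕ → ℝ) (z p n : ℕ) : ℝ :=
  if p ∣ n ∧ 2 ≤ n ∧ ¬ IsPrimePow n ∧ (∀ q ∈ n.primeFactors, q ≠ p → z < q) then compMassTerm c n else 0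

end Design

/-! ### Registered sub-goal: the vocabulary unfolds to the registered stub's inline expressions -/

/-- **Registered sub-goal `stub_deficitOfDesign_vocab`** (bookkeeping anchor of this vocabulary file): the defect,
the composite-mass summand, the Riesz–Euler profile and the deficit summand unfold (by `rfl`) to the inline
expressions of the registered stub `stub_deficitOfDesign`, so that its hypotheses AX-A/B/C are literally
`Summable (|dwt c ·|/·)`, `Summable (compMassTerm c)` and the design inequality over `profile`. [folklore] -/
theorem stub_deficitOfDesign_vocab :
    ∀ c : ℕ → ℝ, (∀ n : ℕ, Design.dwt c n = c n - ArithmeticFunction.vonMangoldt n) ∧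
      (∀ n : ℕ, Design.compMassTerm c n = if 2 ≤ n ∧ ¬ IsPrimePow n then
        c n / (n : ℝ) * (∑ q ∈ n.primeFactors, ∑ q' ∈ n.primeFactors.filter (fun q' => q < q'),
          ((Real.sqrt q - 1) / 2) * ((Real.sqrt q' - 1) / 2)) else 0) ∧
      (∀ (S : Finset ℕ) (a : ℕ → ℝ) (φ : ℝ) (n : ℕ), Design.profile S a φ n =
        if ∀ p ∈ S, ¬ (p ^ 2 ∣ n) then
          Real.sqrt (∏ p ∈ S.filter (· ∣ n), (p : ℝ)) * (∏ p ∈ S.filter (· ∣ n), a p) *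
            (1 / 2) ^ (S.filter (· ∣ n)).card * Real.cos (((S.filter (· ∣ n)).card : ℝ) * φ)
        else 0) ∧
      (∀ p : ℕ, Design.deficitTerm c p = if p.Prime then max (Real.log p - c p) 0 / Real.sqrt p else 0) :=
  fun _ => ⟨fun _ => rfl, fun _ => rfl, fun _ _ _ _ => rfl, fun _ => rfl⟩

end Summit.RiemannHypothesis.RiemannHypothesis.Theorems.SignConeConeMagnification

end
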